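import Mathlib
import Summits.CriticalPhenomena.SAWScalingLimit.Theorems.NoFoldBound.Negative.BoundaryRayDomain

/-!
# The nonnegative kernel `D` of the boundary-identity ray

Crux `NoFoldBound` (stmt-CriticalPhenomena-8296), negative side, fourth support file of the
BOUNDARY-IDENTITY RAY. The ray is a symmetric kernel `rayD : Sym2 HexVertex → Sym2 HexVertex → ℝ`
supported on 21 pairs of boundary mid-edges of `Ω = rayOmega` (`BoundaryRayDomain.lean`), with
values in the real subfield `ℚ(√2, √(2+√2))` of `ℚ(ζ₁₆)` written over the basis
`1, t₁ = tA = 2cos(π/8), t₂ = tB = 2cos(π/4) = √2, t₃ = tC = 2cos(3π/8)` with coefficients of denominator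
`≤ 2` (data of the exact certificate `cert_ball_p3_t125.json` attached to the crux item; all 21
values are positive, the value on the target pair `({v,w₁}, {v,w₂})` is `1`).

To keep every evaluation decidable by the kernel, mid-edges are addressed through the integer key
`ekey {x, y} = (k x + k y, k x · k y)` of their two end faces (`k` an affine code of the
coordinates; a pair of integers is determined by its sum and product), and `rayD b m` reads the
coefficient vector off the table `rayEntries` at the keys of `b` and `m` (either order).

* `rayD_symm`, `rayD_nonneg` (positivity of the 21 values from rational enclosures of `√2` and
  `√(2 ± √2)`), `rayD_target : rayD {v,w₁} {v,w₂} = 1`;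
* the remaining DATA of the identities: `w24 = e^{iπ/24}`, the boundary darts `bdarts` of `Ω` in
  coordinates, and the fourteen sources `touched` with a nonzero kernel row.

Sorry-free.
-/

noncomputable section

open Literature.Probability.LatticeModels Literature.Probability.RandomPlanarGeometry.SAW

namespace Summit.CriticalPhenomena.SAWScalingLimit.Theorems.NoFoldBound.Negative.BoundaryRay

/-! ### Keys -/

/-- An affine integer code of the coordinates (injective on the box `|a|, |b| ≤ 4` that contains
the witness domain and its neighbours). -/
def hk (w : HV) : ℤ := 100 * w.1 + 10 * w.2.1 + (if w.2.2 then 1 else 0)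

/-- The key of an ordered pair of coordinates: sum and product of the two codes. -/
def ekeyHV (x y : HV) : ℤ × ℤ := (hk x + hk y, hk x * hk y)

/-- The key of a mid-edge: sum and product of the codes of its two end faces (symmetric, so it
descends to `Sym2`). -/
def ekey : Sym2 HexVertex → ℤ × ℤ :=
  Sym2.lift ⟨fun x y => ekeyHV (toHV x) (toHV y), fun x y => by
    simp only [ekeyHV, add_comm, mul_comm]⟩

/-- `ekey` on an explicit mid-edge. -/
@[simp] theorem ekey_mk (x y : HexVertex) : ekey s(x, y) = ekeyHV (toHV x) (toHV y) := rfl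

/-! ### The table -/

/-- The 21 entries of the ray: `(ob, y, y', om, n)` stands for the pair of boundary mid-edges
`b = {ob, y}`, `m = {y', om}` of `Ω` (`ob, om ∉ Ω`, `y, y' ∈ Ω`) carrying the value
`(n₀ + n₁ t₁ + n₂ t₂ + n₃ t₃)/2` (integer numerators over the common denominator `2`). -/
def rayEntries : List (HV × HV × HV × HV × (ℤ × ℤ × ℤ × ℤ)) :=
  [((0, 2, true), (0, 3, false), (-2, 2, true), (-1, 2, false), (0, 1, 0, 0)),
    ((0, 2, true), (0, 3, false), (3, 0, true), (3, 0, false), (0, 1, 0, 0)),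
    ((-1, 2, false), (-2, 2, true), (-1, 0, false), (-1, 0, true), (0, 1, 0, 0)),
    ((-1, 1, true), (0, 1, false), (0, 1, false), (0, 0, true), (-4, 0, 3, 0)),
    ((-1, 1, true), (0, 1, false), (3, -3, false), (2, -3, true), (-4, 0, 3, 0)),
    ((0, 0, true), (0, 1, false), (1, 0, false), (0, 0, true), (2, 0, 0, 0)),
    ((0, 0, true), (0, 1, false), (1, -2, true), (2, -2, false), (0, 0, 0, 1)),
    ((0, 0, true), (0, 1, false), (3, -3, true), (3, -2, false), (0, 9, 0, -20)),
    ((0, 0, true), (0, 1, false), (1, -4, true), (1, -3, false), (0, -9, 0, 23)),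
    ((-1, 0, true), (-1, 0, false), (0, -1, true), (0, 0, false), (0, 1, 0, 0)),
    ((0, 0, true), (1, 0, false), (0, -1, true), (0, 0, false), (0, 1, 0, 0)),
    ((0, 0, true), (1, 0, false), (1, -2, true), (2, -2, false), (0, 0, 0, 1)),
    ((3, 0, false), (3, 0, true), (4, -1, false), (3, -1, true), (0, 1, 0, 0)),
    ((3, -1, true), (4, -1, false), (3, -3, true), (3, -2, false), (0, 1, 0, 0)),
    ((2, -2, false), (1, -2, true), (3, -3, true), (3, -2, false), (-25, 0, 18, 0)),
    ((2, -2, false), (1, -2, true), (1, -4, true), (1, -3, false), (23, 0, -16, 0)),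
    ((2, -2, false), (1, -2, true), (2, -4, true), (2, -3, false), (2, 0, -1, 0)),
    ((2, -3, true), (3, -3, false), (3, -3, true), (3, -2, false), (0, 1, 0, -2)),
    ((2, -3, true), (3, -3, false), (2, -4, true), (2, -3, false), (0, -2, 0, 5)),
    ((3, -2, false), (3, -3, true), (2, -4, true), (2, -3, false), (9, 0, -6, 0)),
    ((1, -3, false), (1, -4, true), (2, -4, true), (2, -3, false), (-9, 0, 7, 0))]

/-- The key pair of an entry: the keys of its two mid-edges. -/
def entryKeys (e : HV × HV × HV × HV × (ℤ × ℤ × ℤ × ℤ)) : (ℤ × ℤ) × (ℤ × ℤ) :=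
  (ekeyHV e.1 e.2.1, ekeyHV e.2.2.1 e.2.2.2.1)

/-- The coefficient vector at a pair of keys: that of the (first) entry with these keys, in either
order; `0` if there is none. -/
def coefQ (p q : ℤ × ℤ) : ℤ × ℤ × ℤ × ℤ :=
  match rayEntries.find? fun e => decide (entryKeys e = (p, q) ∨ entryKeys e = (q, p)) with
  | some e => e.2.2.2.2
  | none => 0

/-- `t₁ = 2cos(π/8) = √(2+√2)`. -/
def tA : ℝ := 2 * Real.cos (Real.pi / 8)
/-- `t₂ = 2cos(π/4) = √2`. -/
def tB : ℝ := 2 * Real.cos (Real.pi / 4)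
/-- `t₃ = 2cos(3π/8) = √(2-√2)`. -/
def tC : ℝ := 2 * Real.cos (3 * Real.pi / 8)

/-- The value `(n₀ + n₁ t₁ + n₂ t₂ + n₃ t₃)/2` of an integer coefficient vector over the basis
`1, 2cos(π/8), 2cos(π/4), 2cos(3π/8)` of the real subfield of `ℚ(ζ₁₆)`. -/
def evalT (n : ℤ × ℤ × ℤ × ℤ) : ℝ :=
  ((n.1 : ℝ) + (n.2.1 : ℝ) * tA + (n.2.2.1 : ℝ) * tB + (n.2.2.2 : ℝ) * tC) / 2

/-- **The kernel of the ray.** -/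
def rayD (b m : Sym2 HexVertex) : ℝ := evalT (coefQ (ekey b) (ekey m))

/-! ### Symmetry -/

/-- The table lookup is symmetric. -/
theorem coefQ_symm (p q : ℤ × ℤ) : coefQ p q = coefQ q p := by
  have h : (fun e => decide (entryKeys e = (p, q) ∨ entryKeys e = (q, p))) =
      fun e => decide (entryKeys e = (q, p) ∨ entryKeys e = (p, q)) := by
    funext e; simp only [Bool.decide_or, Bool.or_comm]
  simp only [coefQ, h]

/-- **`D` is symmetric.** -/
theorem rayD_symm (b m : Sym2 HexVertex) : rayD b m = rayD m b := by
  simp only [rayD, coefQ_symm (ekey b)]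

/-! ### Positivity -/

/-- `t₂ = √2`. -/
theorem tB_eq : tB = Real.sqrt 2 := by
  rw [tB, Real.cos_pi_div_four]; ring

/-- `t₁ = √(2+√2)`. -/
theorem tA_eq : tA = Real.sqrt (2 + Real.sqrt 2) := by
  rw [tA, Real.cos_pi_div_eight]; ring

/-- `t₃ = √(2-√2)`. -/
theorem tC_eq : tC = Real.sqrt (2 - Real.sqrt 2) := by
  have e : 3 * Real.pi / 8 = Real.pi / 2 - Real.pi / 8 := by ring
  rw [tC, e, Real.cos_pi_div_two_sub, Real.sin_pi_div_eight]
  ring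

/-- Rational enclosures of `t₁, t₂, t₃`. -/
theorem t_bounds :
    1.84775 < tA ∧ tA < 1.84777 ∧ 1.41421 < tB ∧ tB < 1.41422 ∧ 0.76536 < tC ∧ tC < 0.76537 := by
  have s2lo : (1.41421 : ℝ) < Real.sqrt 2 := Real.lt_sqrt_of_sq_lt (by norm_num)
  have s2hi : Real.sqrt 2 < (1.41422 : ℝ) := by
    rw [Real.sqrt_lt' (by norm_num)]; norm_num
  rw [tA_eq, tB_eq, tC_eq]
  refine ⟨?_, ?_, s2lo, s2hi, ?_, ?_⟩
  · exact Real.lt_sqrt_of_sq_lt (by nlinarith)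
  · rw [Real.sqrt_lt' (by norm_num)]; nlinarith
  · exact Real.lt_sqrt_of_sq_lt (by nlinarith)
  · rw [Real.sqrt_lt' (by norm_num)]; nlinarith

/-- **Every entry of the table has a positive value.** -/
theorem entry_pos : ∀ e ∈ rayEntries, 0 < evalT e.2.2.2.2 := by
  obtain ⟨h1, h1', h2, h2', h3, h3'⟩ := t_bounds
  intro e he
  simp only [rayEntries, List.mem_cons, List.not_mem_nil, or_false] at he
  rcases he with rfl | rfl | rfl | rfl | rfl | rfl | rfl | rfl | rfl | rfl | rfl | rfl | rfl | rfl |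
    rfl | rfl | rfl | rfl | rfl | rfl | rfl
  all_goals (simp only [evalT]; norm_num)
  all_goals nlinarith

/-- The lookup returns `0` or the vector of an entry. -/
theorem coefQ_eq_zero_or_mem (p q : ℤ × ℤ) :
    coefQ p q = 0 ∨ ∃ e ∈ rayEntries, coefQ p q = e.2.2.2.2 := by
  unfold coefQ
  cases h : rayEntries.find? (fun e => decide (entryKeys e = (p, q) ∨ entryKeys e = (q, p))) with
  | none => exact Or.inl rfl
  | some e => exact Or.inr ⟨e, List.mem_of_find?_eq_some h, rfl⟩

/-- **`D` is nonnegative.** -/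
theorem rayD_nonneg (b m : Sym2 HexVertex) : 0 ≤ rayD b m := by
  rcases coefQ_eq_zero_or_mem (ekey b) (ekey m) with h | ⟨e, he, h⟩
  · simp [rayD, h, evalT]
  · rw [rayD, h]
    exact (entry_pos e he).le

/-! ### The target value -/

/-- **`D({v,w₁}, {v,w₂}) = 1`.** -/
theorem rayD_target : rayD s(rayV, rayW₁) s(rayV, rayW₂) = 1 := by
  have h : coefQ (ekey s(rayV, rayW₁)) (ekey s(rayV, rayW₂)) = (2, 0, 0, 0) := by
    rw [ekey_mk, ekey_mk, rayV, rayW₁, rayW₂, toHV_ofHV, toHV_ofHV, toHV_ofHV]; decide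
  rw [rayD, h]
  norm_num [evalT]

/-! ### Data for the identities: the 48th root of unity, the boundary darts, the nonzero rows -/

/-- `w = e^{iπ/24}`, a primitive 48th root of unity (all phases and the basis `tᵢ` are polynomials
in `w`). -/
def w24 : ℂ := Complex.exp ((Real.pi / 24 : ℝ) * Complex.I)

/-- The boundary darts `(y, w)` of `Ω` (`y ∈ Ω`, `w ∼ y`, `w ∉ Ω`) in coordinates (65 of them). -/
def bdarts : Finset (Σ _ : HV, HV) :=
  omegaHV.sigma fun y => ((HV.nbrs y).filter fun w => w ∉ omegaHV).toFinset

/-- The fourteen sources whose kernel row is not identically zero, as darts `(y, o)`. -/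
def touched : Finset (Σ _ : HV, HV) :=
  {⟨(0, 3, false), (0, 2, true)⟩, ⟨(-2, 2, true), (-1, 2, false)⟩, ⟨(0, 1, false), (-1, 1, true)⟩,
    ⟨(0, 1, false), (0, 0, true)⟩, ⟨(-1, 0, false), (-1, 0, true)⟩, ⟨(1, 0, false), (0, 0, true)⟩,
    ⟨(3, 0, true), (3, 0, false)⟩, ⟨(0, -1, true), (0, 0, false)⟩, ⟨(4, -1, false), (3, -1, true)⟩,
    ⟨(1, -2, true), (2, -2, false)⟩, ⟨(3, -3, false), (2, -3, true)⟩, ⟨(3, -3, true), (3, -2,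
    false)⟩, ⟨(1, -4, true), (1, -3, false)⟩, ⟨(2, -4, true), (2, -3, false)⟩}


end Summit.CriticalPhenomena.SAWScalingLimit.Theorems.NoFoldBound.Negative.BoundaryRay
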